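import Summits.ResolutionOfSingularities.ResolutionOfSingularities.Theorems.FrobeniusLadderFInjectiveMacaulayficationPencilIntegral
import Summits.ResolutionOfSingularities.ResolutionOfSingularities.Theorems.FrobeniusLadderFInjectiveMacaulayficationPencilPhiPrime
import HarnessLib

/-!
# BED Ω, GLOBAL PATCH (g-b), F4 (c) GLUE, PER-CHART ALGEBRA KIT: primality of the pencil pair `(θ_c, χ_c)` in any pencil variable (transport of ✓ `PencilIntegral.pencilChart_isPrime`
# along variable permutations), the regularity input «`T` regular on `k[y]/(χ, y₀^e)`» for `χ, T` free of `y₀`, and the evaluation / unit bookkeeping used on every chart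
# (crux `FInjectiveMacaulayfication` stmt-ResolutionOfSingularities-15315, chain w45a; res-L1-w45a-plan-1 BOOKED 2026-08-29T08:08:13Z «F4(c) GLUE»; seat res-L1-w45a-stub-3 g14)

[OURS · L1 W4.5a] Support file (`--supports stmt-ResolutionOfSingularities-15315 --as helper`); theorems only; GENERIC (any field, any number of variables); no named fact; NOT a statement of any
manuscript; nothing of the crux is proved. AI-written (AI review is weaker than expert review).

* §1 `prime_rename_equiv`, `isPrime_span_pair_rename_equiv` — primality of an element / of a pair ideal transports along `rename σ` for a permutation `σ` of the variables.
* §2 `mem_span_C_X_pow_iff` (`p ∈ (C χ, X^e) ⊆ D[X]` iff `χ ∣ p.coeff i` for all `i < e`), ★ `reg_of_free` — for `χ` prime and `χ ∤ T` in `k[y₁..y_m]`: `T⁺` is regular on `k[y₀..y_m]/(χ⁺, y₀^e)`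
  (`q⁺ = rename Fin.succ q`) — the `hreg` input of ✓ `pencilChart_isPrime(_last)` when the coefficient `M` is a power of a variable missing from `χ` and `T`.
* §3 `not_mem_span_pair_of_eval`, `not_dvd_of_eval` (a common zero of the generators where the candidate does not vanish), `isUnit_mk_X_of_eq` (`θ = 1 + y_i·T ⇒ ȳ_i` is a unit mod `θ`),
  `isUnit_mk_monomial` (a monomial in unit variables is a unit).
[folklore; cite: Matsumura1987, Thm. 17.4]
-/

set_option linter.dupNamespace false

noncomputable section

open MvPolynomial

namespace Summit.ResolutionOfSingularities.ResolutionOfSingularities.Theorems.FInjectiveMacaulayfication.PencilPairPrimality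

open Summit.ResolutionOfSingularities.ResolutionOfSingularities.Theorems.FInjectiveMacaulayfication

variable (k : Type) [Field k] {m : ℕ}

/-! ## §1 Transport along variable permutations -/

/-- Primality transports along a renaming by a permutation of the variables. [folklore] -/
theorem prime_rename_equiv (σ : Fin m ≃ Fin m) {a : MvPolynomial (Fin m) k} (ha : Prime a) : Prime (rename σ a) :=
  (MulEquiv.prime_iff (renameEquiv k σ)).2 ha

/-- Primality of a pair ideal transports along a renaming by a permutation of the variables. [folklore] -/
theorem isPrime_span_pair_rename_equiv (σ : Fin m ≃ Fin m) {a b : MvPolynomial (Fin m) k} (h : (Ideal.span {a, b}).IsPrime) :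
    (Ideal.span {rename σ a, rename σ b} : Ideal (MvPolynomial (Fin m) k)).IsPrime := by
  set ρ : MvPolynomial (Fin m) k →+* MvPolynomial (Fin m) k := (renameEquiv k σ : MvPolynomial (Fin m) k →+* MvPolynomial (Fin m) k) with hρ
  have hmap : Ideal.map ρ (Ideal.span {a, b}) = Ideal.span {rename σ a, rename σ b} := by
    rw [Ideal.map_span, Set.image_pair]; rfl
  have hcomap : Ideal.span {rename σ a, rename σ b} = (Ideal.span {a, b}).comap (renameEquiv k σ).symm.toRingHom := by
    rw [← hmap, hρ]
    exact (Ideal.comap_symm (renameEquiv k σ).toRingEquiv).symm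
  rw [hcomap]
  exact Ideal.comap_isPrime _ _

/-! ## §2 `T` free of `y₀` is regular modulo `(χ, y₀^e)` -/

/-- In `D[X]`: `p ∈ (C χ, X^e)` iff `χ` divides the coefficients of `p` below degree `e`. [folklore] -/
theorem mem_span_C_X_pow_iff {D : Type} [CommRing D] (χ : D) (e : ℕ) (p : Polynomial D) :
    p ∈ Ideal.span {Polynomial.C χ, Polynomial.X ^ e} ↔ ∀ i < e, χ ∣ p.coeff i := by
  constructor
  · intro hp i hi
    obtain ⟨a, b, rfl⟩ := Ideal.mem_span_pair.mp hp
    rw [Polynomial.coeff_add, mul_comm a, Polynomial.coeff_C_mul, mul_comm b, Polynomial.coeff_X_pow_mul', if_neg (not_le.mpr hi), add_zero]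
    exact dvd_mul_right _ _
  · intro h
    classical
    choose! c hc using h
    -- `p − C χ · (Σ_{i<e} c_i X^i)` has vanishing coefficients below `e`, hence is a multiple of `X^e`
    set A : Polynomial D := ∑ i ∈ Finset.range e, Polynomial.C (c i) * Polynomial.X ^ i with hA
    have hlow : ∀ i < e, (p - Polynomial.C χ * A).coeff i = 0 := by
      intro i hi
      rw [Polynomial.coeff_sub, Polynomial.coeff_C_mul, hA, Polynomial.finsetSum_coeff, hc i hi]
      simp [Polynomial.coeff_X_pow, Finset.sum_ite_eq, hi]
    obtain ⟨q, hq⟩ := (Polynomial.X_pow_dvd_iff).mpr hlow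
    rw [show p = Polynomial.C χ * A + Polynomial.X ^ e * q by rw [← hq]; ring]
    exact Ideal.add_mem _ (Ideal.mul_mem_right _ _ (Ideal.subset_span (by simp))) (Ideal.mul_mem_right _ _ (Ideal.subset_span (by simp)))

/-- ★ **`T⁺` is regular on `k[y₀, y₁, …, y_m]/(χ⁺, y₀^e)`** for `χ` prime in `k[y₁..y_m]` with `χ ∤ T` (`q⁺ = rename Fin.succ q`): `T⁺·t ∈ (χ⁺, y₀^e) ⇒ t ∈ (χ⁺, y₀^e)`. [folklore] -/
theorem reg_of_free (χ T : MvPolynomial (Fin m) k) (hχ : Prime χ) (hT : ¬ χ ∣ T) (e : ℕ) :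
    ∀ t : MvPolynomial (Fin (m + 1)) k, rename Fin.succ T * t ∈ Ideal.span {rename Fin.succ χ, (X 0 : MvPolynomial (Fin (m + 1)) k) ^ e} →
      t ∈ Ideal.span {rename Fin.succ χ, (X 0 : MvPolynomial (Fin (m + 1)) k) ^ e} := by
  intro t ht
  set φ : MvPolynomial (Fin (m + 1)) k ≃+* Polynomial (MvPolynomial (Fin m) k) := (MvPolynomial.finSuccEquiv k m).toRingEquiv with hφ
  have hφq : ∀ q : MvPolynomial (Fin m) k, φ (rename Fin.succ q) = Polynomial.C q := fun q => by
    show MvPolynomial.finSuccEquiv k m _ = _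
    exact PencilIntegral.finSuccEquiv_rename_succ k q
  have hφX : φ (X 0) = Polynomial.X := by
    show MvPolynomial.finSuccEquiv k m _ = _
    exact MvPolynomial.finSuccEquiv_X_zero
  have hmap : (Ideal.span {rename Fin.succ χ, (X 0 : MvPolynomial (Fin (m + 1)) k) ^ e}).map (φ : MvPolynomial (Fin (m + 1)) k →+* Polynomial (MvPolynomial (Fin m) k)) =
      Ideal.span {Polynomial.C χ, Polynomial.X ^ e} := by
    rw [Ideal.map_span, Set.image_pair, RingHom.coe_coe, map_pow, hφq, hφX]
  have key : ∀ q : MvPolynomial (Fin (m + 1)) k, q ∈ Ideal.span {rename Fin.succ χ, (X 0 : MvPolynomial (Fin (m + 1)) k) ^ e} ↔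
      φ q ∈ Ideal.span {Polynomial.C χ, Polynomial.X ^ e} := by
    intro q
    rw [← hmap, Ideal.map_comap_of_equiv, Ideal.mem_comap, RingEquiv.symm_apply_apply]
  rw [key] at ht ⊢
  rw [map_mul, hφq] at ht
  rw [mem_span_C_X_pow_iff] at ht ⊢
  intro i hi
  have h := ht i hi
  rw [Polynomial.coeff_C_mul] at h
  exact (hχ.dvd_or_dvd h).resolve_left hT

/-! ## §3 Evaluation and unit bookkeeping -/

/-- A polynomial not vanishing at a common zero of `a` and `b` is not in `(a, b)`. [elementary] -/
theorem not_mem_span_pair_of_eval (pt : Fin m → k) {a b q : MvPolynomial (Fin m) k} (ha : eval pt a = 0) (hb : eval pt b = 0) (hq : eval pt q ≠ 0) :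
    q ∉ Ideal.span {a, b} := by
  intro h
  obtain ⟨x, y, rfl⟩ := Ideal.mem_span_pair.mp h
  exact hq (by rw [map_add, map_mul, map_mul, ha, hb, mul_zero, mul_zero, add_zero])

/-- A polynomial not vanishing at a zero of `θ` is not divisible by `θ`. [elementary] -/
theorem not_dvd_of_eval (pt : Fin m → k) {θ q : MvPolynomial (Fin m) k} (hθ : eval pt θ = 0) (hq : eval pt q ≠ 0) : ¬ θ ∣ q := by
  rintro ⟨r, rfl⟩
  exact hq (by rw [map_mul, hθ, zero_mul])

/-- `θ = 1 + y_i·T ⇒ ȳ_i` is a unit of `k[y]/(θ)` (with inverse `−T̄`). [elementary] -/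
theorem isUnit_mk_X_of_eq {θ T : MvPolynomial (Fin m) k} (i : Fin m) (h : θ = 1 + X i * T) : IsUnit (Ideal.Quotient.mk (Ideal.span {θ}) (X i)) := by
  refine IsUnit.of_mul_eq_one (Ideal.Quotient.mk (Ideal.span {θ}) (-T)) ?_
  rw [← map_mul, ← (Ideal.Quotient.mk (Ideal.span {θ})).map_one, Ideal.Quotient.eq, Ideal.mem_span_singleton]
  exact ⟨-1, by rw [h]; ring⟩

/-- A monomial all of whose variables are units modulo `θ` is a unit modulo `θ`. [elementary] -/
theorem isUnit_mk_monomial {θ : MvPolynomial (Fin m) k} (M : Fin m →₀ ℕ) (h : ∀ i, M i ≠ 0 → IsUnit (Ideal.Quotient.mk (Ideal.span {θ}) (X i))) :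
    IsUnit (Ideal.Quotient.mk (Ideal.span {θ}) (monomial M (1 : k))) := by
  classical
  rw [monomial_eq, C_1, one_mul, Finsupp.prod_fintype _ _ (fun i => by simp), map_prod]
  refine IsUnit.prod_univ_iff.mpr fun i => ?_
  by_cases hi : M i = 0
  · rw [hi, pow_zero, map_one]; exact isUnit_one
  · rw [map_pow]; exact (h i hi).pow _

end Summit.ResolutionOfSingularities.ResolutionOfSingularities.Theorems.FInjectiveMacaulayfication.PencilPairPrimality

end
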